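import Literature.Geometry.Lorentzian.KerrSchildCoord
import Literature.Geometry.Lorentzian.KerrConvergence

/-!
# Route EIHFluxBalance — `InertialRecession` (E′), stub `stub_slaving` (K1): SPATIAL RIGIDITY of the
# first variation of the painted Kerr–Schild summand (COER-B, pointwise, parameter-free)

Helper file for the crux `stmt-FinalStateConjecture-17403` (evidence note `K1_linear_architecture.md`).
On the lab slab `{x⁰ = t}` the spatial vacuum equations `R_{ij}` see exactly the `W × W` block
(`W = {w : w 0 = 0}`) of the second-jet variation of the painted summand
`S(p)(x) = boostedKerrBilin Λ c M a x`. Here: the `W × W` block of ANY first variation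
`d/ds boostedKerrBilin (Λ s) (c s) M a x` controls all of it, with an ABSOLUTE constant.
* `abs_symmProd_le_of_spatial` — algebra: `N` `η`-null with `N⁰ ≠ 0`, `β(N) = 0`,
  `h = η(N,·) ⊙ β` with `|h(eᵢ,eⱼ)| ≤ δ` on spatial basis vectors ⇒ `|h(v,w)| ≤ 216 δ ‖v‖ ‖w‖`;
* `hasDerivAt_boostedKerrBilin_path` — along any motion the first variation IS such a product
  (`N = Λ ℓ♯(y)`, `β = H′ η(N,·) + 2H η(N′,·)`, `β(N) = 0` because `η(N(s), N(s)) ≡ 0`);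
* `abs_deriv_boostedKerrBilin_le_of_spatial`, `norm_deriv_boostedKerrBilin_le_of_spatial` — COER-B.
No hypothesis on `M`, `a`, the boost, or the point beyond `r > 0`. Mathlib + Literature only. [folklore]
-/

set_option linter.dupNamespace false

noncomputable section

open scoped Topology BigOperators
open Filter Set Function Literature.Geometry.Lorentzian

namespace Summit.FinalStateConjecture.FinalStateConjecture.Theorems.SublinearIsFree.Slaving

/-! ### Coordinates on `E4` -/

/-- A covector on `E4` is its coordinate expansion: `β v = Σ_μ β(e_μ) v^μ`. [folklore] -/
theorem covector_apply_eq_sum (β : E4 →L[ℝ] ℝ) (v : E4) :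
    β v = ∑ μ, β (E4.basisVector μ) * v μ := by
  conv_lhs => rw [Kerr.eq_sum_basisVector v]
  simp [map_sum, map_smul, mul_comm]

/-- `η(N, v)` in coordinates: `−N⁰v⁰ + N¹v¹ + N²v² + N³v³`. [folklore] -/
theorem minkowski_apply_eq (N v : E4) :
    Minkowski.bilin N v = -N 0 * v 0 + N 1 * v 1 + N 2 * v 2 + N 3 * v 3 := by
  rw [Minkowski.bilin_apply]
  simp only [Fin.sum_univ_three, Fin.succ_zero_eq_one, Fin.succ_one_eq_two,
    show (2 : Fin 3).succ = (3 : Fin 4) from rfl]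
  ring

/-- `η(N, e_{i+1}) = N^{i+1}` for the spatial basis vectors. [folklore] -/
theorem minkowski_basisVector_succ (N : E4) (i : Fin 3) :
    Minkowski.bilin N (E4.basisVector i.succ) = N i.succ := by
  rw [minkowski_apply_eq]
  fin_cases i <;> simp [E4.basisVector]

/-- `|x y h| ≤ ρ δ` when `x², y² ≤ ρ` and `|h| ≤ δ`. [folklore] -/
theorem abs_mul_mul_le_aux {x y h ρ δ : ℝ} (hx : x ^ 2 ≤ ρ) (hy : y ^ 2 ≤ ρ) (hh : |h| ≤ δ) :
    |x * y * h| ≤ ρ * δ := by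
  have hxy : |x| * |y| ≤ ρ := by nlinarith [two_mul_le_add_sq |x| |y|, sq_abs x, sq_abs y]
  rw [abs_mul, abs_mul]
  exact mul_le_mul hxy hh (abs_nonneg _) ((sq_nonneg x).trans hx)

/-! ### Algebra: a symmetrised product `η(N,·) ⊙ β` with `N` null is determined by its spatial block -/

/-- **Spatial rigidity of null symmetrised products.** `N` `η`-null with `N 0 ≠ 0`, `β(N) = 0`,
`h(v, w) := η(N, v) β(w) + β(v) η(N, w)` with `|h(eᵢ, eⱼ)| ≤ δ` for `i, j ∈ {1,2,3}` ⇒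
`|h(v, w)| ≤ 216 δ ‖v‖ ‖w‖`. (With `Lᵢ = Nⁱ`, `ρ = Σ Lᵢ² = (N⁰)²`, `σ = Σ Lᵢ β(eᵢ)`:
`Σᵢⱼ LᵢLⱼ h(eᵢ,eⱼ) = 2ρσ`, `Σᵢ Lᵢ h(eᵢ,e_j) = ρ β(e_j) + σ L_j`, `N⁰ β(e₀) + σ = 0`.) [folklore] -/
theorem abs_symmProd_le_of_spatial (N : E4) (β : E4 →L[ℝ] ℝ)
    (hN : Minkowski.bilin N N = 0) (hN0 : N 0 ≠ 0) (hβ : β N = 0) {δ : ℝ}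
    (h : ∀ i j : Fin 3, |Minkowski.bilin N (E4.basisVector i.succ) * β (E4.basisVector j.succ) +
      β (E4.basisVector i.succ) * Minkowski.bilin N (E4.basisVector j.succ)| ≤ δ) (v w : E4) :
    |Minkowski.bilin N v * β w + β v * Minkowski.bilin N w| ≤ 216 * δ * ‖v‖ * ‖w‖ := by
  set L : Fin 3 → ℝ := fun i ↦ N i.succ with hL
  set b : Fin 3 → ℝ := fun i ↦ β (E4.basisVector i.succ) with hb
  set b0 : ℝ := β (E4.basisVector 0) with hb0
  set hh : Fin 3 → Fin 3 → ℝ := fun i j ↦ L i * b j + b i * L j with hhh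
  have hhδ : ∀ i j, |hh i j| ≤ δ := fun i j ↦ by
    have := h i j
    rwa [minkowski_basisVector_succ, minkowski_basisVector_succ] at this
  have hδ0 : 0 ≤ δ := (abs_nonneg _).trans (hhδ 0 0)
  set ρ : ℝ := ∑ i, L i ^ 2 with hρ
  set σ : ℝ := ∑ i, L i * b i with hσ
  have hρN : ρ = N 0 ^ 2 := by
    rw [minkowski_apply_eq] at hN
    simp only [hρ, hL, Fin.sum_univ_three, Fin.succ_zero_eq_one, Fin.succ_one_eq_two]
    have e3 : (2 : Fin 3).succ = (3 : Fin 4) := rfl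
    rw [e3]; nlinarith [hN]
  have hρpos : 0 < ρ := by rw [hρN]; positivity
  have hN0abs : 0 < |N 0| := abs_pos.2 hN0
  have hLsq : ∀ i, L i ^ 2 ≤ ρ := fun i ↦ by
    rw [hρ]; exact Finset.single_le_sum (f := fun i ↦ L i ^ 2) (fun i _ ↦ sq_nonneg (L i))
      (Finset.mem_univ i)
  have hLabs : ∀ i, |L i| ≤ |N 0| := fun i ↦ sq_le_sq.1 (by rw [← hρN]; exact hLsq i)
  have hβN : N 0 * b0 + σ = 0 := by
    rw [covector_apply_eq_sum, Fin.sum_univ_succ] at hβ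
    have hσ' : σ = ∑ i : Fin 3, β (E4.basisVector i.succ) * N i.succ :=
      Finset.sum_congr rfl fun i _ ↦ mul_comm _ _
    rw [hσ', hb0]; linarith [hβ]
  have hid1 : ∑ i, ∑ j, L i * L j * hh i j = 2 * ρ * σ := by
    simp only [hhh, hρ, hσ, Fin.sum_univ_three]; ring
  have hσb : |σ| ≤ 9 / 2 * δ := by
    have h1 : |2 * ρ * σ| ≤ 9 * (ρ * δ) := by
      rw [← hid1]
      calc |∑ i, ∑ j, L i * L j * hh i j| ≤ ∑ i, |∑ j, L i * L j * hh i j| :=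
            Finset.abs_sum_le_sum_abs _ _
        _ ≤ ∑ i, ∑ j, |L i * L j * hh i j| :=
            Finset.sum_le_sum fun i _ ↦ Finset.abs_sum_le_sum_abs _ _
        _ ≤ ∑ _i : Fin 3, ∑ _j : Fin 3, ρ * δ :=
            Finset.sum_le_sum fun i _ ↦ Finset.sum_le_sum fun j _ ↦
              abs_mul_mul_le_aux (hLsq i) (hLsq j) (hhδ i j)
        _ = 9 * (ρ * δ) := by simp; ring
    rw [abs_mul, abs_mul, abs_of_pos hρpos, abs_two] at h1
    nlinarith [abs_nonneg σ]
  have hid2 : ∀ j, ∑ i, L i * hh i j = ρ * b j + σ * L j := fun j ↦ by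
    simp only [hhh, hρ, hσ, Fin.sum_univ_three]; ring
  have hbj : ∀ j, |N 0| * |b j| ≤ 15 / 2 * δ := fun j ↦ by
    have h1 : |∑ i, L i * hh i j| ≤ 3 * (|N 0| * δ) := by
      calc |∑ i, L i * hh i j| ≤ ∑ i, |L i * hh i j| := Finset.abs_sum_le_sum_abs _ _
        _ ≤ ∑ _i : Fin 3, |N 0| * δ := Finset.sum_le_sum fun i _ ↦ by
            rw [abs_mul]; exact mul_le_mul (hLabs i) (hhδ i j) (abs_nonneg _) (abs_nonneg _)
        _ = 3 * (|N 0| * δ) := by simp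
    rw [hid2 j] at h1
    have h2 : ρ * |b j| ≤ 3 * (|N 0| * δ) + 9 / 2 * δ * |N 0| := by
      have : |ρ * b j| ≤ |ρ * b j + σ * L j| + |σ * L j| := by
        have := abs_add_le (ρ * b j + σ * L j) (-(σ * L j))
        simpa [abs_neg] using this
      rw [abs_mul, abs_of_pos hρpos, abs_mul] at this
      nlinarith [mul_le_mul hσb (hLabs j) (abs_nonneg _) (by linarith), abs_nonneg σ,
        abs_nonneg (L j)]
    rw [hρN, ← sq_abs] at h2
    nlinarith [abs_nonneg (b j)]
  have hb0b : |N 0| * |b0| ≤ 9 / 2 * δ := by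
    have : N 0 * b0 = -σ := by linarith
    rw [← abs_mul, this, abs_neg]; exact hσb
  have hNv : ∀ u : E4, |Minkowski.bilin N u| ≤ 4 * |N 0| * ‖u‖ := fun u ↦ by
    rw [minkowski_apply_eq]
    have h0 : |u 0| ≤ ‖u‖ := by simpa using PiLp.norm_apply_le u 0
    have h1 : |u 1| ≤ ‖u‖ := by simpa using PiLp.norm_apply_le u 1
    have h2 : |u 2| ≤ ‖u‖ := by simpa using PiLp.norm_apply_le u 2
    have h3 : |u 3| ≤ ‖u‖ := by simpa using PiLp.norm_apply_le u 3
    have hL1 := hLabs 0; have hL2 := hLabs 1; have hL3 := hLabs 2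
    simp only [hL, Fin.succ_zero_eq_one, Fin.succ_one_eq_two] at hL1 hL2 hL3
    have e3 : (2 : Fin 3).succ = (3 : Fin 4) := rfl
    rw [e3] at hL3
    calc |-N 0 * u 0 + N 1 * u 1 + N 2 * u 2 + N 3 * u 3|
        ≤ |-N 0 * u 0| + |N 1 * u 1| + |N 2 * u 2| + |N 3 * u 3| := by
          linarith [abs_add_le (-N 0 * u 0 + N 1 * u 1 + N 2 * u 2) (N 3 * u 3),
            abs_add_le (-N 0 * u 0 + N 1 * u 1) (N 2 * u 2), abs_add_le (-N 0 * u 0) (N 1 * u 1)]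
      _ ≤ 4 * |N 0| * ‖u‖ := by
          rw [abs_mul, abs_mul, abs_mul, abs_mul, abs_neg]
          nlinarith [mul_le_mul hL1 h1 (abs_nonneg _) (abs_nonneg _),
            mul_le_mul hL2 h2 (abs_nonneg _) (abs_nonneg _),
            mul_le_mul hL3 h3 (abs_nonneg _) (abs_nonneg _),
            mul_le_mul_of_nonneg_left h0 (abs_nonneg (N 0))]
  have hβu : ∀ u : E4, |N 0| * |β u| ≤ 27 * δ * ‖u‖ := fun u ↦ by
    rw [covector_apply_eq_sum]
    have h0 : |u 0| ≤ ‖u‖ := by simpa using PiLp.norm_apply_le u 0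
    have h1 : |u 1| ≤ ‖u‖ := by simpa using PiLp.norm_apply_le u 1
    have h2 : |u 2| ≤ ‖u‖ := by simpa using PiLp.norm_apply_le u 2
    have h3 : |u 3| ≤ ‖u‖ := by simpa using PiLp.norm_apply_le u 3
    have hb1 := hbj 0; have hb2 := hbj 1; have hb3 := hbj 2
    simp only [hb, Fin.succ_zero_eq_one, Fin.succ_one_eq_two] at hb1 hb2 hb3
    have e3 : (2 : Fin 3).succ = (3 : Fin 4) := rfl
    rw [e3] at hb3
    simp only [Fin.sum_univ_four]
    calc |N 0| * |β (E4.basisVector 0) * u 0 + β (E4.basisVector 1) * u 1 +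
          β (E4.basisVector 2) * u 2 + β (E4.basisVector 3) * u 3|
        ≤ |N 0| * (|β (E4.basisVector 0) * u 0| + |β (E4.basisVector 1) * u 1| +
          |β (E4.basisVector 2) * u 2| + |β (E4.basisVector 3) * u 3|) := by
          refine mul_le_mul_of_nonneg_left ?_ (abs_nonneg _)
          set p0 := β (E4.basisVector 0) * u 0; set p1 := β (E4.basisVector 1) * u 1
          set p2 := β (E4.basisVector 2) * u 2; set p3 := β (E4.basisVector 3) * u 3
          linarith [abs_add_le (p0 + p1 + p2) p3, abs_add_le (p0 + p1) p2, abs_add_le p0 p1]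
      _ ≤ 27 * δ * ‖u‖ := by
          rw [abs_mul, abs_mul, abs_mul, abs_mul]
          nlinarith [mul_le_mul hb0b h0 (abs_nonneg _) (by positivity),
            mul_le_mul hb1 h1 (abs_nonneg _) (by positivity),
            mul_le_mul hb2 h2 (abs_nonneg _) (by positivity),
            mul_le_mul hb3 h3 (abs_nonneg _) (by positivity)]
  have hvn := norm_nonneg v; have hwn := norm_nonneg w
  have t1 : |Minkowski.bilin N v * β w| ≤ 108 * δ * ‖v‖ * ‖w‖ := by
    rw [abs_mul]
    calc |Minkowski.bilin N v| * |β w| ≤ 4 * |N 0| * ‖v‖ * |β w| :=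
          mul_le_mul_of_nonneg_right (hNv v) (abs_nonneg _)
      _ = 4 * ‖v‖ * (|N 0| * |β w|) := by ring
      _ ≤ 4 * ‖v‖ * (27 * δ * ‖w‖) := mul_le_mul_of_nonneg_left (hβu w) (by positivity)
      _ = 108 * δ * ‖v‖ * ‖w‖ := by ring
  have t2 : |β v * Minkowski.bilin N w| ≤ 108 * δ * ‖v‖ * ‖w‖ := by
    rw [abs_mul]
    calc |β v| * |Minkowski.bilin N w| ≤ |β v| * (4 * |N 0| * ‖w‖) :=
          mul_le_mul_of_nonneg_left (hNv w) (abs_nonneg _)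
      _ = 4 * ‖w‖ * (|N 0| * |β v|) := by ring
      _ ≤ 4 * ‖w‖ * (27 * δ * ‖v‖) := mul_le_mul_of_nonneg_left (hβu v) (by positivity)
      _ = 108 * δ * ‖v‖ * ‖w‖ := by ring
  calc |Minkowski.bilin N v * β w + β v * Minkowski.bilin N w|
      ≤ |Minkowski.bilin N v * β w| + |β v * Minkowski.bilin N w| := abs_add_le _ _
    _ ≤ 108 * δ * ‖v‖ * ‖w‖ + 108 * δ * ‖v‖ * ‖w‖ := add_le_add t1 t2
    _ = 216 * δ * ‖v‖ * ‖w‖ := by ring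


/-! ### The painted summand along a motion: `boostedKerrBilin = η + 2H · η(N,·) ⊗ η(N,·)` -/

/-- `η(Λ u, v) = η(u, Λ⁻¹ v)` for `Λ ∈ O(1,3)` (O'Neill 1983, Ch. 9, p. 233). [folklore] -/
theorem minkowski_lorentz_left (Λ : lorentzGroup) (u v : E4) :
    Minkowski.bilin ((Λ : E4 ≃L[ℝ] E4) u) v = Minkowski.bilin u ((Λ : E4 ≃L[ℝ] E4).symm v) := by
  have h := Λ.2 u ((Λ : E4 ≃L[ℝ] E4).symm v)
  rwa [ContinuousLinearEquiv.apply_symm_apply] at h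

/-- **The painted summand is `η + 2H · L ⊗ L` with `L = η(N, ·)`**:
`boostedKerrBilin Λ c M a x v w = η(v, w) + 2H(y) η(N, v) η(N, w)`, `N = Λ ℓ♯(y)`, `y = Λ⁻¹(x − c)`
(Kerr–Schild 1965; Lorentz covariance of the ansatz). [folklore] -/
theorem boostedKerrBilin_eq_minkowski_add (Λ : lorentzGroup) (c : E4) (M a : ℝ) (x v w : E4) :
    boostedKerrBilin Λ c M a x v w = Minkowski.bilin v w +
      2 * Kerr.scalarH M a (poincareInv Λ c x) *
        (Minkowski.bilin (((Λ : E4 ≃L[ℝ] E4) : E4 →L[ℝ] E4) (Kerr.nullVector a (poincareInv Λ c x))) v * Minkowski.bilin (((Λ : E4 ≃L[ℝ] E4) : E4 →L[ℝ] E4) (Kerr.nullVector a (poincareInv Λ c x))) w) := by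
  rw [boostedKerrBilin_apply, Kerr.bilin_apply,
    show Minkowski.bilin ((Λ : E4 ≃L[ℝ] E4).symm v) ((Λ : E4 ≃L[ℝ] E4).symm w) = Minkowski.bilin v w
      from (lorentzGroup.inv_mem Λ.2) v w]
  simp only [ContinuousLinearEquiv.coe_coe, minkowski_lorentz_left, Kerr.bilin_nullVector]

/-- A nonzero `η`-null vector has nonzero time component. [folklore] -/
theorem apply_zero_ne_zero_of_null {N : E4} (hN : Minkowski.bilin N N = 0) (hne : N ≠ 0) :
    N 0 ≠ 0 := by
  intro h0
  apply hne
  rw [minkowski_apply_eq, h0] at hN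
  have h1 : N 1 = 0 := by nlinarith [sq_nonneg (N 1), sq_nonneg (N 2), sq_nonneg (N 3)]
  have h2 : N 2 = 0 := by nlinarith [sq_nonneg (N 1), sq_nonneg (N 2), sq_nonneg (N 3)]
  have h3 : N 3 = 0 := by nlinarith [sq_nonneg (N 1), sq_nonneg (N 2), sq_nonneg (N 3)]
  ext μ
  fin_cases μ <;> simp [h0, h1, h2, h3]

/-- The boosted null vector `N = Λ ℓ♯(y)` is `η`-null wherever `r(y) > 0`. [folklore] -/
theorem minkowski_boostedNull_self (Λ : lorentzGroup) (c : E4) (a : ℝ) (x : E4)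
    (hx : 0 < Kerr.radius a (poincareInv Λ c x)) :
    Minkowski.bilin (((Λ : E4 ≃L[ℝ] E4) : E4 →L[ℝ] E4) (Kerr.nullVector a (poincareInv Λ c x))) (((Λ : E4 ≃L[ℝ] E4) : E4 →L[ℝ] E4) (Kerr.nullVector a (poincareInv Λ c x))) = 0 := by
  rw [ContinuousLinearEquiv.coe_coe, Λ.2, Kerr.bilin_nullVector, Kerr.nullCovector_nullVector hx]

/-- The boosted null vector has nonzero time component (`ℓ♯ ≠ 0` since `ℓ(e₀) = 1`). [folklore] -/
theorem boostedNull_apply_zero_ne_zero (Λ : lorentzGroup) (c : E4) (a : ℝ) (x : E4)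
    (hx : 0 < Kerr.radius a (poincareInv Λ c x)) : (((Λ : E4 ≃L[ℝ] E4) : E4 →L[ℝ] E4) (Kerr.nullVector a (poincareInv Λ c x))) 0 ≠ 0 := by
  refine apply_zero_ne_zero_of_null (minkowski_boostedNull_self Λ c a x hx) fun h ↦ ?_
  have h1 : Kerr.nullVector a (poincareInv Λ c x) = 0 := by
    simpa using congrArg (Λ : E4 ≃L[ℝ] E4).symm h
  have h2 := Kerr.bilin_nullVector a (poincareInv Λ c x) (E4.basisVector 0)
  rw [h1, Kerr.nullCovector_basisVector_zero, map_zero, zero_apply] at h2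
  exact zero_ne_one h2

/-! ### The first variation along a motion is a null symmetrised product -/

section Path

variable {Λ : ℝ → lorentzGroup} {c : ℝ → E4} {M a : ℝ} {x : E4} {s₀ : ℝ}

/-- Differentiability of `s ↦ Λ(s)⁻¹` (as operators) from that of `s ↦ Λ(s)`: inversion is smooth
on the units (`ContinuousLinearMap.inverse`). [folklore] -/
theorem differentiableAt_lorentz_symm
    (hΛ : DifferentiableAt ℝ (fun s ↦ ((Λ s : E4 ≃L[ℝ] E4) : E4 →L[ℝ] E4)) s₀) :
    DifferentiableAt ℝ (fun s ↦ (((Λ s : E4 ≃L[ℝ] E4).symm : E4 →L[ℝ] E4))) s₀ := by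
  have h : (fun s ↦ (((Λ s : E4 ≃L[ℝ] E4).symm : E4 →L[ℝ] E4))) =
      ContinuousLinearMap.inverse ∘ (fun s ↦ ((Λ s : E4 ≃L[ℝ] E4) : E4 →L[ℝ] E4)) :=
    funext fun s ↦ (ContinuousLinearMap.inverse_equiv (Λ s : E4 ≃L[ℝ] E4)).symm
  rw [h]
  exact ((contDiffAt_map_inverse (n := 1) (Λ s₀ : E4 ≃L[ℝ] E4)).differentiableAt
    one_ne_zero).comp s₀ hΛ

/-- The rest-frame point `y(s) = Λ(s)⁻¹(x − c(s))` is differentiable along a `C¹` motion. [folklore] -/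
theorem differentiableAt_poincareInv_path
    (hΛ : DifferentiableAt ℝ (fun s ↦ ((Λ s : E4 ≃L[ℝ] E4) : E4 →L[ℝ] E4)) s₀)
    (hc : DifferentiableAt ℝ c s₀) :
    DifferentiableAt ℝ (fun s ↦ poincareInv (Λ s) (c s) x) s₀ := by
  have h : (fun s ↦ poincareInv (Λ s) (c s) x) =
      fun s ↦ (((Λ s : E4 ≃L[ℝ] E4).symm : E4 →L[ℝ] E4)) (x - c s) := rfl
  rw [h]
  exact (differentiableAt_lorentz_symm hΛ).clm_apply ((differentiableAt_const x).sub hc)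

/-- **The first variation of the painted summand along a motion is a null symmetrised product**:
for a motion differentiable at `s₀` and `r(y(s₀)) > 0` there are `N₀` (`η`-null, `N₀⁰ ≠ 0`) and `β`
with `β(N₀) = 0` such that `d/ds|_{s₀} boostedKerrBilin (Λ s) (c s) M a x v w = η(N₀,v)β(w) + β(v)η(N₀,w)`
(`N₀ = Λ ℓ♯(y)`, `β = H′ η(N₀,·) + 2H η(N′,·)`; `β(N₀) = 0` as `η(N(s),N(s)) = 0` near `s₀`). [folklore] -/
theorem hasDerivAt_boostedKerrBilin_path
    (hΛ : DifferentiableAt ℝ (fun s ↦ ((Λ s : E4 ≃L[ℝ] E4) : E4 →L[ℝ] E4)) s₀)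
    (hc : DifferentiableAt ℝ c s₀) (hx : 0 < Kerr.radius a (poincareInv (Λ s₀) (c s₀) x)) :
    ∃ (N₀ : E4) (β : E4 →L[ℝ] ℝ), Minkowski.bilin N₀ N₀ = 0 ∧ N₀ 0 ≠ 0 ∧ β N₀ = 0 ∧
      ∀ v w : E4, HasDerivAt (fun s ↦ boostedKerrBilin (Λ s) (c s) M a x v w)
        (Minkowski.bilin N₀ v * β w + β v * Minkowski.bilin N₀ w) s₀ := by
  set y : ℝ → E4 := fun s ↦ poincareInv (Λ s) (c s) x with hy
  set N : ℝ → E4 := fun s ↦ ((Λ s : E4 ≃L[ℝ] E4) : E4 →L[ℝ] E4) (Kerr.nullVector a (y s)) with hN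
  set H : ℝ → ℝ := fun s ↦ Kerr.scalarH M a (y s) with hH
  have hyd : DifferentiableAt ℝ y s₀ := differentiableAt_poincareInv_path hΛ hc
  have hnV : DifferentiableAt ℝ (fun s ↦ Kerr.nullVector a (y s)) s₀ :=
    DifferentiableAt.comp (g := Kerr.nullVector a) (f := y) s₀
      ((Kerr.contDiffAt_nullVector a hx (n := 1)).differentiableAt one_ne_zero) hyd
  have hsH : DifferentiableAt ℝ (fun s ↦ Kerr.scalarH M a (y s)) s₀ :=
    DifferentiableAt.comp (g := Kerr.scalarH M a) (f := y) s₀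
      ((Kerr.contDiffAt_scalarH M a hx (n := 1)).differentiableAt one_ne_zero) hyd
  have hNd : DifferentiableAt ℝ N s₀ := hΛ.clm_apply hnV
  set N₀ : E4 := N s₀ with hN₀
  set N' : E4 := deriv N s₀ with hN'
  set H₀ : ℝ := H s₀ with hH₀
  set H' : ℝ := deriv H s₀ with hH'
  have hnull_ev : ∀ᶠ s in 𝓝 s₀, Minkowski.bilin (N s) (N s) = 0 := by
    have hcont : ContinuousAt (fun s ↦ Kerr.radius a (y s)) s₀ :=
      (Kerr.continuous_radius a).continuousAt.comp hyd.continuousAt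
    filter_upwards [hcont.eventually (lt_mem_nhds hx)] with s hs
    exact minkowski_boostedNull_self (Λ s) (c s) a x hs
  have hnull0 : Minkowski.bilin N₀ N₀ = 0 := hnull_ev.self_of_nhds
  have hN00 : N₀ 0 ≠ 0 := boostedNull_apply_zero_ne_zero (Λ s₀) (c s₀) a x hx
  have hbN : HasDerivAt (fun s ↦ Minkowski.bilin (N s)) (Minkowski.bilin N') s₀ :=
    Minkowski.bilin.hasFDerivAt.comp_hasDerivAt s₀ hNd.hasDerivAt
  have hNN : HasDerivAt (fun s ↦ Minkowski.bilin (N s) (N s))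
      (Minkowski.bilin N' N₀ + Minkowski.bilin N₀ N') s₀ := hbN.clm_apply hNd.hasDerivAt
  have hNN0 : Minkowski.bilin N' N₀ + Minkowski.bilin N₀ N' = 0 := by
    have h0 : HasDerivAt (fun s ↦ Minkowski.bilin (N s) (N s)) 0 s₀ :=
      (hasDerivAt_const s₀ (0 : ℝ)).congr_of_eventuallyEq hnull_ev
    exact hNN.unique h0
  have hN'N : Minkowski.bilin N' N₀ = 0 := by
    rw [Minkowski.bilin_symm N₀ N'] at hNN0; linarith
  set β : E4 →L[ℝ] ℝ := H' • Minkowski.bilin N₀ + (2 * H₀) • Minkowski.bilin N' with hβ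
  have hβN : β N₀ = 0 := by
    change H' • Minkowski.bilin N₀ N₀ + (2 * H₀) • Minkowski.bilin N' N₀ = 0
    rw [hnull0, hN'N, smul_zero, smul_zero, add_zero]
  refine ⟨N₀, β, hnull0, hN00, hβN, fun v w ↦ ?_⟩
  have hform : (fun s ↦ boostedKerrBilin (Λ s) (c s) M a x v w) =
      fun s ↦ Minkowski.bilin v w + 2 * H s * (Minkowski.bilin (N s) v * Minkowski.bilin (N s) w) :=
    funext fun s ↦ boostedKerrBilin_eq_minkowski_add (Λ s) (c s) M a x v w
  rw [hform]
  have hPv : HasDerivAt (fun s ↦ Minkowski.bilin (N s) v) (Minkowski.bilin N' v) s₀ := by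
    have := hbN.clm_apply (hasDerivAt_const s₀ v)
    simpa only [map_zero, add_zero] using this
  have hPw : HasDerivAt (fun s ↦ Minkowski.bilin (N s) w) (Minkowski.bilin N' w) s₀ := by
    have := hbN.clm_apply (hasDerivAt_const s₀ w)
    simpa only [map_zero, add_zero] using this
  have hall := ((hsH.hasDerivAt.const_mul 2).mul (hPv.mul hPw)).const_add (Minkowski.bilin v w)
  refine hall.congr_deriv ?_
  change _ = Minkowski.bilin N₀ v * (H' • Minkowski.bilin N₀ w + (2 * H₀) • Minkowski.bilin N' w) +
    (H' • Minkowski.bilin N₀ v + (2 * H₀) • Minkowski.bilin N' v) * Minkowski.bilin N₀ w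
  simp only [smul_eq_mul, Pi.mul_apply, ← hN₀]
  ring

/-- **COER-B (pointwise, parameter-free).** For a motion `s ↦ (Λ s, c s)` differentiable at `s₀`,
a lab point with rest-frame Kerr–Schild radius `> 0`, and `δ` bounding the nine spatial components
`|d/ds boostedKerrBilin (Λ s) (c s) M a x eᵢ eⱼ|`, EVERY component is `≤ 216 δ ‖v‖ ‖w‖`. No
hypothesis on `M`, `a`, the boost or the point: the lab slab enters only through `W`. [folklore] -/
theorem abs_deriv_boostedKerrBilin_le_of_spatial
    (hΛ : DifferentiableAt ℝ (fun s ↦ ((Λ s : E4 ≃L[ℝ] E4) : E4 →L[ℝ] E4)) s₀)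
    (hc : DifferentiableAt ℝ c s₀) (hx : 0 < Kerr.radius a (poincareInv (Λ s₀) (c s₀) x)) {δ : ℝ}
    (hδ : ∀ i j : Fin 3, |deriv (fun s ↦ boostedKerrBilin (Λ s) (c s) M a x
      (E4.basisVector i.succ) (E4.basisVector j.succ)) s₀| ≤ δ) (v w : E4) :
    |deriv (fun s ↦ boostedKerrBilin (Λ s) (c s) M a x v w) s₀| ≤ 216 * δ * ‖v‖ * ‖w‖ := by
  obtain ⟨N₀, β, hnull, hN0, hβN, hder⟩ := hasDerivAt_boostedKerrBilin_path (M := M) hΛ hc hx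
  rw [(hder v w).deriv]
  refine abs_symmProd_le_of_spatial N₀ β hnull hN0 hβN (fun i j ↦ ?_) v w
  rw [← (hder _ _).deriv]
  exact hδ i j

/-- Operator form of COER-B: if the operator-valued path `s ↦ boostedKerrBilin (Λ s) (c s) M a x` has
derivative `T′` at `s₀` whose nine spatial components are `≤ δ` in absolute value, then
`|T′ v w| ≤ 216 δ ‖v‖ ‖w‖` for all `v, w` and `‖T′‖ ≤ 216 δ`. [folklore] -/
theorem norm_deriv_boostedKerrBilin_le_of_spatial
    (hΛ : DifferentiableAt ℝ (fun s ↦ ((Λ s : E4 ≃L[ℝ] E4) : E4 →L[ℝ] E4)) s₀)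
    (hc : DifferentiableAt ℝ c s₀) (hx : 0 < Kerr.radius a (poincareInv (Λ s₀) (c s₀) x))
    {T' : E4 →L[ℝ] E4 →L[ℝ] ℝ}
    (hT : HasDerivAt (fun s ↦ boostedKerrBilin (Λ s) (c s) M a x) T' s₀) {δ : ℝ}
    (hδ : ∀ i j : Fin 3, |T' (E4.basisVector i.succ) (E4.basisVector j.succ)| ≤ δ) :
    (∀ v w : E4, |T' v w| ≤ 216 * δ * ‖v‖ * ‖w‖) ∧ ‖T'‖ ≤ 216 * δ := by
  have hvw : ∀ v w : E4, HasDerivAt (fun s ↦ boostedKerrBilin (Λ s) (c s) M a x v w) (T' v w) s₀ :=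
    fun v w ↦ by
      have h1 : HasDerivAt (fun s ↦ boostedKerrBilin (Λ s) (c s) M a x v) (T' v) s₀ := by
        simpa using hT.clm_apply (hasDerivAt_const s₀ v)
      simpa using h1.clm_apply (hasDerivAt_const s₀ w)
  have hδ0 : 0 ≤ δ := (abs_nonneg _).trans (hδ 0 0)
  have hall : ∀ v w : E4, |T' v w| ≤ 216 * δ * ‖v‖ * ‖w‖ := fun v w ↦ by
    rw [← (hvw v w).deriv]
    refine abs_deriv_boostedKerrBilin_le_of_spatial (M := M) hΛ hc hx (fun i j ↦ ?_) v w
    rw [(hvw _ _).deriv]; exact hδ i j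
  refine ⟨hall, ContinuousLinearMap.opNorm_le_bound _ (by positivity) fun v ↦
    ContinuousLinearMap.opNorm_le_bound _ (by positivity) fun w ↦ ?_⟩
  rw [Real.norm_eq_abs]
  calc |T' v w| ≤ 216 * δ * ‖v‖ * ‖w‖ := hall v w
    _ = 216 * δ * ‖v‖ * ‖w‖ := rfl

end Path

/-- COER-B, explicit-binder form (registered carrier `slaving_spatialRigidity_slaving12` of the crux item
`stmt-FinalStateConjecture-17403`): `abs_deriv_boostedKerrBilin_le_of_spatial` verbatim. [folklore] -/
theorem slaving_spatialRigidity_slaving12 : open Literature.Geometry.Lorentzian in ∀ {Λ : ℝ → lorentzGroup} {c : ℝ → E4} {M a : ℝ} {x : E4} {s₀ : ℝ}, DifferentiableAt ℝ (fun s ↦ ((Λ s : E4 ≃L[ℝ] E4) : E4 →L[ℝ] E4)) s₀ → DifferentiableAt ℝ c s₀ → 0 < Kerr.radius a (poincareInv (Λ s₀) (c s₀) x) → ∀ {δ : ℝ}, (∀ i j : Fin 3, |deriv (fun s ↦ boostedKerrBilin (Λ s) (c s) M a x (E4.basisVector i.succ) (E4.basisVector j.succ)) s₀| ≤ δ) →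 ∀ v w : E4, |deriv (fun s ↦ boostedKerrBilin (Λ s) (c s) M a x v w) s₀| ≤ 216 * δ * ‖v‖ * ‖w‖ :=
  fun hΛ hc hx _ hδ v w ↦ abs_deriv_boostedKerrBilin_le_of_spatial hΛ hc hx hδ v w

end Summit.FinalStateConjecture.FinalStateConjecture.Theorems.SublinearIsFree.Slaving
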